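import Summits.AtomisticToContinuum.Crystallization.Theorems.HolmgrenBoyleLindGroundStatesChargeFLCEquilibriumStubTightness
import Summits.AtomisticToContinuum.Crystallization.Theorems.HolmgrenBoyleLindGroundStatesChargeFLCEquilibriumTwoPointPalm

/-!
# Crux `HolmgrenBoyleLind.GroundStatesChargeFLCEquilibrium` (stmt-AtomisticToContinuum-6076):
# tightness of the content stub, II — the carrier and the normalisation hypotheses

The registered content stub `stub_minimisingLawsChargeFLC` of the line `registered` has five
hypotheses on the law `P` of rooted configurations of `ℝ³`: (H1) `0 < δ`, (H2) `P` is a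
probability law, (H3) a.s. the configuration is a rooted `δ`-hard-core COUNTING measure
`count|S` (`0 ∈ S`, `S` `δ`-separated), (H4) point-stationarity (Mecke identity) and (H5)
minimisation `∫ (∫ V_LJ ‖y‖ dμ) / 2 dP ≤ e* = ⨅_Q e(Q)`. The companion file `…StubTightness`
certifies that (H4) and (H5) are each indispensable. This file does the same for (H2) and (H3),
using the Palm law of the two-point cluster `{0, e}` (`‖e‖ = 1`) with atom weight `w`,
`P_w = ½ (δ_{w δ_0 + w δ_e} + δ_{w δ_0 + w δ_{-e}})` (file `…TwoPointPalm`): a point-stationary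
probability law for every `w`, carried by configurations inside the closed unit ball — hence
charging no Delone set (`patchEvent_measure_zero_of_ae_bounded`) — with mean root energy
`w · V_LJ(1) / 2 = −w/24`.

* `stub_minimisingLawsChargeFLC_false_without_support` — dropping (H3) wholesale: with
  `w = n ≥ −24 e*` the law `P_n` satisfies (H2), (H4), (H5) and charges nothing. What excludes it
  in the stub is exactly the unit-weight (simple counting measure) clause of (H3): heavy atoms buy
  root energy without neighbours.
* `stub_minimisingLawsChargeFLC_false_without_probability` — dropping (H2): the unit-weight Palm
  law `P_1` satisfies (H3) with `δ = 1` and (H4); the non-probability law `n • P_1`,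
  `n ≥ −24 e*`, still does, satisfies (H5) (its "mean" root energy is `−n/24`) and charges
  nothing. So the normalisation of `P` is what gives (H5) its meaning.

Together with `…StubTightness`: each of (H2)–(H5) is indispensable, kernel-checked. (H1) and the
clauses of (H3) finer than "unit weights" (rootedness, separation) are not testable by explicit
laws — any unit-weight test law must be an exact minimiser among point-stationary laws, i.e.
requires knowing Lennard-Jones minimisers in `d = 3`. All `[folklore]`; helper file for item
stmt-AtomisticToContinuum-6076 (`--supports`); nothing here closes an item or bears on the truth
of the stub itself (an open problem, BlancLewin2015 §2.3).
-/

noncomputable section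

open MeasureTheory Filter Set
open scoped ENNReal Topology

namespace Summit.AtomisticToContinuum.Crystallization.Theorems.HolmgrenBoyleLindGroundStatesChargeFLCEquilibrium

open Literature.MathematicalPhysics.StatisticalMechanics Literature.Probability.Process


/-! ### The carrier hypothesis (H3) cannot be dropped -/

/-- **Stub 1 without the counting-measure carrier hypothesis is FALSE.** The statement obtained
from the registered stub `stub_minimisingLawsChargeFLC` by deleting the hypothesis "a.s.
`μ = count|S` with `0 ∈ S`, `S` `δ`-separated" fails: for `n ≥ −24 e*` the Palm law of the
two-point cluster `{0, e}` (`‖e‖ = 1`) with atom WEIGHT `n`,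
`P = ½ (δ_{n δ_0 + n δ_e} + δ_{n δ_0 + n δ_{-e}})`, is a probability law
(`isProbabilityMeasure_twoPointPalm`), point-stationary (`isPointStationaryLaw_twoPointPalm`),
has mean root energy `n · V_LJ(1) / 2 = −n/24 ≤ e*`, and is carried by configurations inside the
closed unit ball, so it charges no `r`-dense set (`patchEvent_measure_zero_of_ae_bounded`). What
excludes this law in the stub is precisely the unit-weight (simple counting measure) clause of
(H3): heavy atoms buy root energy without neighbours. [folklore] -/
theorem stub_minimisingLawsChargeFLC_false_without_support :
    ¬ (∀ δ : ℝ, 0 < δ → ∀ P : Measure (Measure (EuclideanSpace ℝ (Fin 3))), IsProbabilityMeasure P →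
      (∀ g : Measure (EuclideanSpace ℝ (Fin 3)) → EuclideanSpace ℝ (Fin 3) → ENNReal,
        Measurable (Function.uncurry g) →
        ∫⁻ μ, ∫⁻ y, g μ y ∂μ ∂P = ∫⁻ μ, ∫⁻ y, g (Measure.map (fun z => z - y) μ) (-y) ∂μ ∂P) →
      (∫ μ, (∫ y, lennardJones ‖y‖ ∂μ) / 2 ∂P) ≤
        (⨅ Q : PeriodicConfiguration 3, Q.energyPerParticle lennardJones) →
      ∃ (Λ : Set (EuclideanSpace ℝ (Fin 3))) (δ' r : ℝ), 0 < δ' ∧ 0 < r ∧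
        (∀ x ∈ Λ, ∀ y ∈ Λ, x ≠ y → δ' ≤ dist x y) ∧
        (∀ c : EuclideanSpace ℝ (Fin 3), ∃ y ∈ Λ, dist y c ≤ r) ∧
        (∀ R : ℝ, Set.Finite {S : Set (EuclideanSpace ℝ (Fin 3)) |
          ∃ x ∈ Λ, S = {v : EuclideanSpace ℝ (Fin 3) | x + v ∈ Λ ∧ ‖v‖ ≤ R}}) ∧
        ∃ q₀ ∈ Λ, ∀ R ε : ℝ, 0 < R → 0 < ε →
          P {ν : Measure (EuclideanSpace ℝ (Fin 3)) |
              ∃ A : EuclideanSpace ℝ (Fin 3) →ₗᵢ[ℝ] EuclideanSpace ℝ (Fin 3),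
                (∀ s ∈ Λ, dist s q₀ ≤ R →
                  ∃ p : EuclideanSpace ℝ (Fin 3), ν {p} ≠ 0 ∧ dist p (A (s - q₀)) ≤ ε) ∧
                (∀ p : EuclideanSpace ℝ (Fin 3), ν {p} ≠ 0 → ‖p‖ ≤ R →
                  ∃ s ∈ Λ, dist p (A (s - q₀)) ≤ ε)} ≠ 0) := by
  intro h
  set estar : ℝ := ⨅ Q : PeriodicConfiguration 3, Q.energyPerParticle lennardJones with hestar
  -- the atom weight
  obtain ⟨n, hn⟩ := exists_nat_ge (-24 * estar)
  -- the unit vector `e`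
  set e : EuclideanSpace ℝ (Fin 3) := EuclideanSpace.single (0 : Fin 3) (1 : ℝ) with he
  have henorm : ‖e‖ = 1 := by
    rw [he, PiLp.norm_single, norm_one]
  have hnenorm : ‖-e‖ = 1 := by rw [norm_neg, henorm]
  have hw : ((n : ℝ≥0∞)) ≠ ∞ := ENNReal.natCast_ne_top n
  -- the weighted two-point Palm law
  have hP := isProbabilityMeasure_twoPointPalm (n : ℝ≥0∞) e
  have hstat := (isPointStationaryLaw_twoPointPalm (n : ℝ≥0∞) e).smul (2 : ℝ≥0∞)⁻¹
  have hE : (∫ μ, (∫ y, lennardJones ‖y‖ ∂μ) / 2 ∂(((2 : ℝ≥0∞)⁻¹ •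
      (Measure.dirac ((n : ℝ≥0∞) • Measure.dirac (0 : EuclideanSpace ℝ (Fin 3)) + (n : ℝ≥0∞) • Measure.dirac e) +
        Measure.dirac ((n : ℝ≥0∞) • Measure.dirac (0 : EuclideanSpace ℝ (Fin 3)) + (n : ℝ≥0∞) • Measure.dirac (-e)))) :
      Measure (Measure (EuclideanSpace ℝ (Fin 3))))) ≤ estar := by
    rw [integral_twoPointPalm, rootEnergy_twoPoint hw henorm, rootEnergy_twoPoint hw hnenorm,
      ENNReal.toReal_natCast]
    linarith
  obtain ⟨Λ, δ', r, -, hr, -, hden, -, q₀, -, hch⟩ := h 1 one_pos _ hP hstat hE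
  -- the law is carried by configurations inside the closed unit ball
  have hbd := ae_twoPointPalm_measure_compl_closedBall (n : ℝ≥0∞) e
  rw [henorm] at hbd
  obtain ⟨R, ε, hR, hε, h0⟩ := patchEvent_measure_zero_of_ae_bounded zero_le_one hbd hr hden q₀
  exact hch R ε hR hε h0

/-! ### The probability (normalisation) hypothesis (H2) cannot be dropped -/

/-- **Stub 1 without the probability hypothesis is FALSE.** The statement obtained from the
registered stub `stub_minimisingLawsChargeFLC` by deleting `IsProbabilityMeasure P` fails: the
unit-weight Palm law `P_1 = ½ (δ_{δ_0 + δ_e} + δ_{δ_0 + δ_{-e}})` of the two-point cluster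
`{0, e}` (`‖e‖ = 1`) is a.s. a rooted `1`-hard-core counting measure and point-stationary; the
NON-probability law `n • P_1` with `n ≥ −24 e*` keeps both properties, satisfies the minimisation
inequality `∫ (∫ V_LJ ‖y‖ dμ)/2 d(n • P_1) = −n/24 ≤ e*`, and charges no `r`-dense set (it is
carried by configurations inside the closed unit ball). So the normalisation of `P` is what
gives the minimisation hypothesis its meaning. [folklore] -/
theorem stub_minimisingLawsChargeFLC_false_without_probability :
    ¬ (∀ δ : ℝ, 0 < δ → ∀ P : Measure (Measure (EuclideanSpace ℝ (Fin 3))),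
      (∀ᵐ μ ∂P, (∃ S : Set (EuclideanSpace ℝ (Fin 3)), (0 : EuclideanSpace ℝ (Fin 3)) ∈ S ∧
        (∀ x ∈ S, ∀ y ∈ S, x ≠ y → δ ≤ dist x y) ∧
        μ = (Measure.count : Measure (EuclideanSpace ℝ (Fin 3))).restrict S)) →
      (∀ g : Measure (EuclideanSpace ℝ (Fin 3)) → EuclideanSpace ℝ (Fin 3) → ENNReal,
        Measurable (Function.uncurry g) →
        ∫⁻ μ, ∫⁻ y, g μ y ∂μ ∂P = ∫⁻ μ, ∫⁻ y, g (Measure.map (fun z => z - y) μ) (-y) ∂μ ∂P) →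
      (∫ μ, (∫ y, lennardJones ‖y‖ ∂μ) / 2 ∂P) ≤
        (⨅ Q : PeriodicConfiguration 3, Q.energyPerParticle lennardJones) →
      ∃ (Λ : Set (EuclideanSpace ℝ (Fin 3))) (δ' r : ℝ), 0 < δ' ∧ 0 < r ∧
        (∀ x ∈ Λ, ∀ y ∈ Λ, x ≠ y → δ' ≤ dist x y) ∧
        (∀ c : EuclideanSpace ℝ (Fin 3), ∃ y ∈ Λ, dist y c ≤ r) ∧
        (∀ R : ℝ, Set.Finite {S : Set (EuclideanSpace ℝ (Fin 3)) |
          ∃ x ∈ Λ, S = {v : EuclideanSpace ℝ (Fin 3) | x + v ∈ Λ ∧ ‖v‖ ≤ R}}) ∧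
        ∃ q₀ ∈ Λ, ∀ R ε : ℝ, 0 < R → 0 < ε →
          P {ν : Measure (EuclideanSpace ℝ (Fin 3)) |
              ∃ A : EuclideanSpace ℝ (Fin 3) →ₗᵢ[ℝ] EuclideanSpace ℝ (Fin 3),
                (∀ s ∈ Λ, dist s q₀ ≤ R →
                  ∃ p : EuclideanSpace ℝ (Fin 3), ν {p} ≠ 0 ∧ dist p (A (s - q₀)) ≤ ε) ∧
                (∀ p : EuclideanSpace ℝ (Fin 3), ν {p} ≠ 0 → ‖p‖ ≤ R →
                  ∃ s ∈ Λ, dist p (A (s - q₀)) ≤ ε)} ≠ 0) := by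
  intro h
  set estar : ℝ := ⨅ Q : PeriodicConfiguration 3, Q.energyPerParticle lennardJones with hestar
  obtain ⟨n, hn⟩ := exists_nat_ge (-24 * estar)
  set e : EuclideanSpace ℝ (Fin 3) := EuclideanSpace.single (0 : Fin 3) (1 : ℝ) with he
  have henorm : ‖e‖ = 1 := by
    rw [he, PiLp.norm_single, norm_one]
  have hnenorm : ‖-e‖ = 1 := by rw [norm_neg, henorm]
  -- the unit-weight two-point Palm law `P₁` and the non-probability law `n • P₁`
  obtain ⟨P₁, hP₁⟩ : ∃ P₁ : Measure (Measure (EuclideanSpace ℝ (Fin 3))), P₁ = ((2 : ℝ≥0∞)⁻¹ •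
      (Measure.dirac ((1 : ℝ≥0∞) • Measure.dirac (0 : EuclideanSpace ℝ (Fin 3)) + (1 : ℝ≥0∞) • Measure.dirac e) +
        Measure.dirac ((1 : ℝ≥0∞) • Measure.dirac (0 : EuclideanSpace ℝ (Fin 3)) + (1 : ℝ≥0∞) • Measure.dirac (-e)))) :=
    ⟨_, rfl⟩
  have hSp : ({0, e} : Set (EuclideanSpace ℝ (Fin 3))).Finite := (finite_singleton e).insert 0
  have hSm : ({0, -e} : Set (EuclideanSpace ℝ (Fin 3))).Finite := (finite_singleton (-e)).insert 0
  have hp0 := twoPoint_measure_compl (1 : ℝ≥0∞) e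
  have hm0 := twoPoint_measure_compl (1 : ℝ≥0∞) (-e)
  -- (H3) with `δ = 1`
  have hcore₁ : ∀ᵐ μ ∂P₁, (∃ S : Set (EuclideanSpace ℝ (Fin 3)), (0 : EuclideanSpace ℝ (Fin 3)) ∈ S ∧
      (∀ x ∈ S, ∀ y ∈ S, x ≠ y → (1 : ℝ) ≤ dist x y) ∧
      μ = (Measure.count : Measure (EuclideanSpace ℝ (Fin 3))).restrict S) := by
    rw [hP₁]
    refine Measure.ae_smul_measure (ae_add_measure_iff.2 ⟨?_, ?_⟩) _
    · exact (ae_eq_dirac_of_measure_compl_finite hSp hp0).mono fun μ hμ => by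
        rw [hμ]
        exact isRootedHardCore_twoPoint_one henorm
    · exact (ae_eq_dirac_of_measure_compl_finite hSm hm0).mono fun μ hμ => by
        rw [hμ]
        exact isRootedHardCore_twoPoint_one hnenorm
  have hcore : ∀ᵐ μ ∂((n : ℝ≥0∞) • P₁), (∃ S : Set (EuclideanSpace ℝ (Fin 3)), (0 : EuclideanSpace ℝ (Fin 3)) ∈ S ∧
      (∀ x ∈ S, ∀ y ∈ S, x ≠ y → (1 : ℝ) ≤ dist x y) ∧
      μ = (Measure.count : Measure (EuclideanSpace ℝ (Fin 3))).restrict S) :=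
    Measure.ae_smul_measure hcore₁ _
  -- (H4)
  have hstat : IsPointStationaryLaw ((n : ℝ≥0∞) • P₁) := by
    rw [hP₁]
    exact ((isPointStationaryLaw_twoPointPalm (1 : ℝ≥0∞) e).smul (2 : ℝ≥0∞)⁻¹).smul (n : ℝ≥0∞)
  -- (H5): the "mean" root energy of `n • P₁` is `-n/24`
  have hE : (∫ μ, (∫ y, lennardJones ‖y‖ ∂μ) / 2 ∂((n : ℝ≥0∞) • P₁)) ≤ estar := by
    rw [integral_smul_measure, hP₁, integral_twoPointPalm, rootEnergy_twoPoint ENNReal.one_ne_top henorm,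
      rootEnergy_twoPoint ENNReal.one_ne_top hnenorm, ENNReal.toReal_natCast, ENNReal.toReal_one,
      smul_eq_mul]
    linarith
  obtain ⟨Λ, δ', r, -, hr, -, hden, -, q₀, -, hch⟩ := h 1 one_pos _ hcore hstat hE
  -- `P₁` is carried by configurations inside the closed unit ball, so it charges nothing
  have hbd := ae_twoPointPalm_measure_compl_closedBall (1 : ℝ≥0∞) e
  rw [henorm] at hbd
  obtain ⟨R, ε, hR, hε, h0⟩ := patchEvent_measure_zero_of_ae_bounded zero_le_one hbd hr hden q₀
  refine hch R ε hR hε ?_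
  rw [Measure.smul_apply, smul_eq_mul, hP₁, h0, mul_zero]

end Summit.AtomisticToContinuum.Crystallization.Theorems.HolmgrenBoyleLindGroundStatesChargeFLCEquilibrium

end
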